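import Summits.ResolutionOfSingularities.ResolutionOfSingularities.Theorems.EquisingularLiftEquisingularLiftNatSubchainPointResolutionOff
import HarnessLib

/-!
# [OURS · L1 W4.5(b) · EL♮ / EL♮(3) · T23-A⁗] K5″ — THE T-ISO ENGINE WITH SUB-CHAIN SUPPLIERS AND INITIAL-STAGE LETTERED TOWERS (any `n`)
# = K5′ `target_elnat_of_subchainResolution'` (…NatSubchainPointResolutionOff, res-D-pv-029) with ONE MORE closure case of the downstairs motive

res-L1-w45b-stub-2 g13 (desk R29/R30 DEAL «rung⁵/instance⁵ = stub-2»; TAKING 2026-08-28T12:39:30Z). The A⁗ residue hypothesis `IsoHypDefTowerBQuadPrime`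
(res-L1-w45b-lead-2 g6, …NatResidueHypDefs4) has the shape `∃ F' ρ' T', (∀ Q, seed → ⟨point step ∧ generic towers⟩ → ⟨INITIAL-STAGE lettered towers⟩ →
Q F' ρ' T') ∧ regular`; K5′ knows the first two clauses only. OURS; NOT a statement of any manuscript; AI-written, weaker than expert review. No `sorry`;
standard axioms; DEF-FREE (parametric in the three predicates). `--supports stmt-ResolutionOfSingularities-20148 --as helper`.

WHAT. `target_elnat_of_subchainResolution_letters`: K5′ VERBATIM plus — binders `ReachL` (the lettered reach predicate of the INITIAL stage:
`F₂, υ : F₂ ⟶ ℙⁿ_k, x₀, T₂, Ls₂, F₉, β, T₉`) and `LS` (the admissible-letter predicate: `F₂, υ, x₀, Ls₂`; instance⁵ puts «every `L ∈ Ls₂` is the strict transform of a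
hyperplane through `x₀` not containing `H`»); a SECOND supplier hypothesis `HSUB₂(ReachL, LS)` = K5′'s `HSUB` with the stage SPECIALISED TO THE CONCRETE INITIAL STAGE
`(ℙⁿ_O, 𝟙, Y)` with model `ℙⁿ_k` and base square `Proj.map φ` (`φ = MvPolynomial.map θ` degreewise) — concrete because only there can the rung BUILD the letters'
upstairs models `V₊(ℓ̃) ⊂ ℙⁿ_O` (res-type-027 (H2)/(H3), my …NatLinearFormSectionLift) — plus `(Ls₂) (LS F₂ υ x Ls₂)` before the reach hypothesis; `hres` = blob #21's
shape; conclusion = K5′'s. PROOF = K5′'s model-square induction (adapted copy) with a third closure case: the point step is run at the base stage by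
`modelPointStep_chain'`, T-DIM by `ringKrullDim_stalk_eq_succ_of_chain`, then `HSUB₂`. [folklore; assembly] (method; index only).
-/

set_option linter.dupNamespace false -- mandated namespace `Summit.<Summit>.<Problem>` of this single-conjunct summit
set_option linter.overlappingInstances false -- signatures carry `[IsDomain O] [IsDiscreteValuationRing O]`

noncomputable section

open CategoryTheory CategoryTheory.Limits AlgebraicGeometry TopologicalSpace Topology
open MvPolynomial
open Literature.AlgebraicGeometry.Resolution
open AlgebraicGeometry.Scheme.IdealSheafData
open Summit.ResolutionOfSingularities.ResolutionOfSingularities.Theses.EquisingularLift.Split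
open Summit.ResolutionOfSingularities.ResolutionOfSingularities.Cruxes.EquisingularLift.StrataSplit

namespace Summit.ResolutionOfSingularities.ResolutionOfSingularities.Cruxes.EquisingularLiftNat.Sections

/-- **K5″: the T-ISO engine with sub-chain suppliers AND initial-stage lettered towers** (any `n`; parametric in `Reach`, `ReachL`, `LS`; conditional on
`HSUB(Reach)` and `HSUB₂(ReachL, LS)`). See the module docstring. [folklore; K5′ (res-D-pv-029) + one closure case] -/
theorem target_elnat_of_subchainResolution_letters (p : ℕ) : p.Prime → ∀ (k : Type) [Field k] [CharP k p] [IsAlgClosed k] (n : ℕ)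
    (H : AlgebraicGeometry.Scheme.{0}) (ι : H ⟶ (Literature.AlgebraicGeometry.Motives.projectiveSpace n k).left),
    AlgebraicGeometry.IsClosedImmersion ι → AlgebraicGeometry.IsIntegral H → (∀ y : (Literature.AlgebraicGeometry.Motives.projectiveSpace n k).left,
      ∃ U : (Literature.AlgebraicGeometry.Motives.projectiveSpace n k).left.affineOpens,
        y ∈ (U : (Literature.AlgebraicGeometry.Motives.projectiveSpace n k).left.Opens) ∧ (ι.ker.ideal U).IsPrincipal) →
    -- the downstairs admissibility predicate of carrier traces and the LIFT HYPOTHESIS HΔ(Adm)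
    ∀ (Reach : ∀ (F₁ F₂ : AlgebraicGeometry.Scheme.{0}), (F₂ ⟶ F₁) → F₁ → Set F₂ → ∀ (F₉ : AlgebraicGeometry.Scheme.{0}), (F₉ ⟶ F₂) → Set F₉ → Prop)
      -- the LETTERED reach predicate of the INITIAL stage and the admissible-letter predicate (A⁗)
      (ReachL : ∀ (F₂ : AlgebraicGeometry.Scheme.{0}), (F₂ ⟶ (Literature.AlgebraicGeometry.Motives.projectiveSpace n k).left) → (Literature.AlgebraicGeometry.Motives.projectiveSpace n k).left → Set F₂ → List (Set F₂) →
        ∀ (F₉ : AlgebraicGeometry.Scheme.{0}), (F₉ ⟶ F₂) → Set F₉ → Prop)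
      (LS : ∀ (F₂ : AlgebraicGeometry.Scheme.{0}), (F₂ ⟶ (Literature.AlgebraicGeometry.Motives.projectiveSpace n k).left) → (Literature.AlgebraicGeometry.Motives.projectiveSpace n k).left → List (Set F₂) → Prop),
    -- THE SUB-CHAIN SUPPLIER HSUB(Reach): in the engine's context (base `q : P → Spec O`, closed irreducible `Y` in the special
    -- fibre, stage predicate `Ch` closed under horizontal E1 steps and implying `Split.Chain`), after the point step at `x`
    -- (section `s`, blow-up `τ₁`, model squares `j`, `j₂`, carrier identity, T-DIM), every `Reach`-admissible downstairs
    -- sub-chain `(F₉, β, T₉)` is matched by a `Ch`-stage with a model square for `F₉`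
    (∀ (O : Type) [CommRing O] [IsDomain O] [IsDiscreteValuationRing O] [IsAdicComplete (IsLocalRing.maximalIdeal O) O]
        [IsAlgClosed (IsLocalRing.ResidueField O)] (θ : O →+* k), Function.Surjective θ →
      ∀ (P : AlgebraicGeometry.Scheme.{0}) (q : P ⟶ AlgebraicGeometry.Spec (.of O)) (Y : Set P) (Ch : ∀ X' : AlgebraicGeometry.Scheme.{0}, (X' ⟶ P) → Set X' → Prop),
        (∀ (X' X'' : AlgebraicGeometry.Scheme.{0}) (σ' : X' ⟶ P) (S' : Set X') (C : X'.IdealSheafData) (τ : X'' ⟶ X'),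
          Ch X' σ' S' → Literature.AlgebraicGeometry.Resolution.IsBlowup τ C →
          Literature.AlgebraicGeometry.Resolution.Scheme.IsRegular C.subscheme → AlgebraicGeometry.Flat (C.subschemeι ≫ σ' ≫ q) →
          σ' '' (C.support : Set X') ⊆ {y | ¬ IsGenericPoint y Y} → (C.support : Set X') ∩ (σ' ≫ q) ⁻¹' {IsLocalRing.closedPoint O} ⊆ S' →
          Ch X'' (τ ≫ σ') (closure (τ ⁻¹' (S' \ (C.support : Set X'))))) → (∀ (X' : AlgebraicGeometry.Scheme.{0}) (σ' : X' ⟶ P) (S' : Set X'), Ch X' σ' S' →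
          Summit.ResolutionOfSingularities.ResolutionOfSingularities.Theses.EquisingularLift.Split.Chain P Y X' σ' S') →
        Y ⊆ q ⁻¹' {IsLocalRing.closedPoint O} → IsIrreducible Y → IsClosed Y →
        AlgebraicGeometry.IsIntegral P → IsLocallyNoetherian P → Literature.AlgebraicGeometry.Resolution.Scheme.IsRegular P →
        AlgebraicGeometry.IsProper q → AlgebraicGeometry.SmoothOfRelativeDimension n q →
      -- the stage before the point step and its model
      ∀ (X' : AlgebraicGeometry.Scheme.{0}) (σ' : X' ⟶ P) (S' : Set X'), Ch X' σ' S' → AlgebraicGeometry.IsIntegral X' →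
        IsLocallyNoetherian X' → Literature.AlgebraicGeometry.Resolution.Scheme.IsRegular X' → AlgebraicGeometry.IsDominant (σ' ≫ q) →
      ∀ (F₁ : AlgebraicGeometry.Scheme.{0}), AlgebraicGeometry.IsIntegral F₁ → ∀ (j : F₁ ⟶ X') (t : F₁ ⟶ AlgebraicGeometry.Spec (.of k)),
        IsPullback j t (σ' ≫ q) (AlgebraicGeometry.Spec.map (CommRingCat.ofHom θ)) → ∀ (T₁ : Set F₁), IsClosed T₁ → IsIrreducible T₁ → j '' T₁ = S' →
      -- the point step: section, its blow-up, the new stage and its model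
      ∀ (x : F₁) (hx : IsClosed ({x} : Set F₁)) (U : X'.Opens), AlgebraicGeometry.Smooth (U.ι ≫ σ' ≫ q) →
      ∀ (s : AlgebraicGeometry.Spec (.of O) ⟶ X'), s ≫ σ' ≫ q = 𝟙 _ → s (IsLocalRing.closedPoint O) ∈ U → s (IsLocalRing.closedPoint O) = j x →
        ringKrullDim (X'.presheaf.stalk (s (IsLocalRing.closedPoint O))) = ((n + 1 : ℕ) : WithBot ℕ∞) → IsRegularLocalRing (F₁.presheaf.stalk x) →
        (∀ c ∈ (s.ker.support : Set X'), ¬ IsGenericPoint (σ' c) Y) →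
      ∀ (X₁ : AlgebraicGeometry.Scheme.{0}) (τ₁ : X₁ ⟶ X'), Literature.AlgebraicGeometry.Resolution.IsBlowup τ₁ s.ker →
        AlgebraicGeometry.IsIntegral X₁ → IsLocallyNoetherian X₁ → Literature.AlgebraicGeometry.Resolution.Scheme.IsRegular X₁ → AlgebraicGeometry.IsDominant ((τ₁ ≫ σ') ≫ q) →
      ∀ (F₂ : AlgebraicGeometry.Scheme.{0}), AlgebraicGeometry.IsIntegral F₂ → ∀ (υ : F₂ ⟶ F₁), Literature.AlgebraicGeometry.Resolution.IsBlowup υ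
          (AlgebraicGeometry.Scheme.IdealSheafData.vanishingIdeal (⟨{x}, hx⟩ : TopologicalSpace.Closeds F₁)) → ∀ (j₂ : F₂ ⟶ X₁) (t₂ : F₂ ⟶ AlgebraicGeometry.Spec (.of k)),
        IsPullback j₂ t₂ ((τ₁ ≫ σ') ≫ q) (AlgebraicGeometry.Spec.map (CommRingCat.ofHom θ)) → j₂ ≫ τ₁ = υ ≫ j → (s.ker.comap τ₁).comap j₂ =
          (AlgebraicGeometry.Scheme.IdealSheafData.vanishingIdeal (⟨{x}, hx⟩ : TopologicalSpace.Closeds F₁)).comap υ → IsIrreducible (closure (υ ⁻¹' (T₁ \ {x}))) →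
        Ch X₁ (τ₁ ≫ σ') (j₂ '' closure (υ ⁻¹' (T₁ \ {x}))) →
      -- the admissible downstairs sub-chains are matched upstairs
      ∀ (F₉ : AlgebraicGeometry.Scheme.{0}) (β : F₉ ⟶ F₂) (T₉ : Set F₉), Reach F₁ F₂ υ x (closure (υ ⁻¹' (T₁ \ {x}))) F₉ β T₉ →
        ∃ (X₉ : AlgebraicGeometry.Scheme.{0}) (σ₉ : X₉ ⟶ P) (S₉ : Set X₉) (j₉ : F₉ ⟶ X₉) (t₉ : F₉ ⟶ AlgebraicGeometry.Spec (.of k)),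
          Ch X₉ σ₉ S₉ ∧ AlgebraicGeometry.IsIntegral X₉ ∧ IsLocallyNoetherian X₉ ∧
          Literature.AlgebraicGeometry.Resolution.Scheme.IsRegular X₉ ∧ AlgebraicGeometry.IsDominant (σ₉ ≫ q) ∧
          IsPullback j₉ t₉ (σ₉ ≫ q) (AlgebraicGeometry.Spec.map (CommRingCat.ofHom θ)) ∧ j₉ '' T₉ = S₉ ∧ IsClosed T₉ ∧ IsIrreducible T₉ ∧ AlgebraicGeometry.IsIntegral F₉) →
    -- THE INITIAL-STAGE LETTERED SUPPLIER HSUB₂(ReachL, LS): the same, at the CONCRETE initial stage `(ℙⁿ_O, 𝟙, Y)` with model `ℙⁿ_k`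
    (∀ (O : Type) [CommRing O] [IsDomain O] [IsDiscreteValuationRing O] [IsAdicComplete (IsLocalRing.maximalIdeal O) O]
        [IsAlgClosed (IsLocalRing.ResidueField O)] (θ : O →+* k), Function.Surjective θ → (letI := MvPolynomial.gradedAlgebra (σ := Fin (n + 1)) (R := O);
       letI := MvPolynomial.gradedAlgebra (σ := Fin (n + 1)) (R := k); ∀ (φ : MvPolynomial.homogeneousSubmodule (Fin (n + 1)) O →+*ᵍ MvPolynomial.homogeneousSubmodule (Fin (n + 1)) k)
        (hφ' : HomogeneousIdeal.irrelevant (MvPolynomial.homogeneousSubmodule (Fin (n + 1)) k) ≤ (HomogeneousIdeal.irrelevant (MvPolynomial.homogeneousSubmodule (Fin (n + 1)) O)).map φ),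
        (∀ s, φ s = MvPolynomial.map θ s) → ∀ (Ch : ∀ X' : AlgebraicGeometry.Scheme.{0}, (X' ⟶ (AlgebraicGeometry.Proj (MvPolynomial.homogeneousSubmodule (Fin (n + 1)) O))) → Set X' → Prop),
        (∀ (X' X'' : AlgebraicGeometry.Scheme.{0}) (σ' : X' ⟶ (AlgebraicGeometry.Proj (MvPolynomial.homogeneousSubmodule (Fin (n + 1)) O))) (S' : Set X') (C : X'.IdealSheafData) (τ : X'' ⟶ X'),
          Ch X' σ' S' → Literature.AlgebraicGeometry.Resolution.IsBlowup τ C →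
          Literature.AlgebraicGeometry.Resolution.Scheme.IsRegular C.subscheme → AlgebraicGeometry.Flat (C.subschemeι ≫ σ' ≫ (AlgebraicGeometry.Proj.toSpecZero (MvPolynomial.homogeneousSubmodule (Fin (n + 1)) O) ≫ AlgebraicGeometry.Spec.map (CommRingCat.ofHom (algebraMap O (MvPolynomial.homogeneousSubmodule (Fin (n + 1)) O 0))))) →
          σ' '' (C.support : Set X') ⊆ {y | ¬ IsGenericPoint y (Set.range (ι ≫ AlgebraicGeometry.Proj.map φ hφ' : H ⟶ AlgebraicGeometry.Proj (MvPolynomial.homogeneousSubmodule (Fin (n + 1)) O)))} →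
          (C.support : Set X') ∩ (σ' ≫ (AlgebraicGeometry.Proj.toSpecZero (MvPolynomial.homogeneousSubmodule (Fin (n + 1)) O) ≫ AlgebraicGeometry.Spec.map (CommRingCat.ofHom (algebraMap O (MvPolynomial.homogeneousSubmodule (Fin (n + 1)) O 0))))) ⁻¹' {IsLocalRing.closedPoint O} ⊆ S' →
          Ch X'' (τ ≫ σ') (closure (τ ⁻¹' (S' \ (C.support : Set X'))))) →
        (∀ (X' : AlgebraicGeometry.Scheme.{0}) (σ' : X' ⟶ (AlgebraicGeometry.Proj (MvPolynomial.homogeneousSubmodule (Fin (n + 1)) O))) (S' : Set X'), Ch X' σ' S' →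
          Summit.ResolutionOfSingularities.ResolutionOfSingularities.Theses.EquisingularLift.Split.Chain (AlgebraicGeometry.Proj (MvPolynomial.homogeneousSubmodule (Fin (n + 1)) O)) (Set.range (ι ≫ AlgebraicGeometry.Proj.map φ hφ' : H ⟶ AlgebraicGeometry.Proj (MvPolynomial.homogeneousSubmodule (Fin (n + 1)) O))) X' σ' S') →
        (Set.range (ι ≫ AlgebraicGeometry.Proj.map φ hφ' : H ⟶ AlgebraicGeometry.Proj (MvPolynomial.homogeneousSubmodule (Fin (n + 1)) O))) ⊆ (AlgebraicGeometry.Proj.toSpecZero (MvPolynomial.homogeneousSubmodule (Fin (n + 1)) O) ≫ AlgebraicGeometry.Spec.map (CommRingCat.ofHom (algebraMap O (MvPolynomial.homogeneousSubmodule (Fin (n + 1)) O 0)))) ⁻¹' {IsLocalRing.closedPoint O} → IsIrreducible (Set.range (ι ≫ AlgebraicGeometry.Proj.map φ hφ' : H ⟶ AlgebraicGeometry.Proj (MvPolynomial.homogeneousSubmodule (Fin (n + 1)) O))) → IsClosed (Set.range (ι ≫ AlgebraicGeometry.Proj.map φ hφ' : H ⟶ AlgebraicGeometry.Proj (MvPolynomial.homogeneousSubmodule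 (Fin (n + 1)) O))) →
        AlgebraicGeometry.IsIntegral (AlgebraicGeometry.Proj (MvPolynomial.homogeneousSubmodule (Fin (n + 1)) O)) → IsLocallyNoetherian (AlgebraicGeometry.Proj (MvPolynomial.homogeneousSubmodule (Fin (n + 1)) O)) → Literature.AlgebraicGeometry.Resolution.Scheme.IsRegular (AlgebraicGeometry.Proj (MvPolynomial.homogeneousSubmodule (Fin (n + 1)) O)) →
        AlgebraicGeometry.IsProper (AlgebraicGeometry.Proj.toSpecZero (MvPolynomial.homogeneousSubmodule (Fin (n + 1)) O) ≫ AlgebraicGeometry.Spec.map (CommRingCat.ofHom (algebraMap O (MvPolynomial.homogeneousSubmodule (Fin (n + 1)) O 0)))) → AlgebraicGeometry.SmoothOfRelativeDimension n (AlgebraicGeometry.Proj.toSpecZero (MvPolynomial.homogeneousSubmodule (Fin (n + 1)) O) ≫ AlgebraicGeometry.Spec.map (CommRingCat.ofHom (algebraMap O (MvPolynomial.homogeneousSubmodule (Fin (n + 1)) O 0)))) →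
      -- the INITIAL stage `(ℙⁿ_O, 𝟙, Y)` and its model `ℙⁿ_k` (the base model square `Proj.map φ`)
      Ch (AlgebraicGeometry.Proj (MvPolynomial.homogeneousSubmodule (Fin (n + 1)) O)) (𝟙 (AlgebraicGeometry.Proj (MvPolynomial.homogeneousSubmodule (Fin (n + 1)) O))) (Set.range (ι ≫ AlgebraicGeometry.Proj.map φ hφ' : H ⟶ AlgebraicGeometry.Proj (MvPolynomial.homogeneousSubmodule (Fin (n + 1)) O))) → AlgebraicGeometry.IsDominant (𝟙 (AlgebraicGeometry.Proj (MvPolynomial.homogeneousSubmodule (Fin (n + 1)) O)) ≫ (AlgebraicGeometry.Proj.toSpecZero (MvPolynomial.homogeneousSubmodule (Fin (n + 1)) O) ≫ AlgebraicGeometry.Spec.map (CommRingCat.ofHom (algebraMap O (MvPolynomial.homogeneousSubmodule (Fin (n + 1)) O 0))))) →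
      AlgebraicGeometry.IsIntegral (Literature.AlgebraicGeometry.Motives.projectiveSpace n k).left →
      ∀ (t : (Literature.AlgebraicGeometry.Motives.projectiveSpace n k).left ⟶ AlgebraicGeometry.Spec (.of k)),
        IsPullback (AlgebraicGeometry.Proj.map φ hφ' : (Literature.AlgebraicGeometry.Motives.projectiveSpace n k).left ⟶ AlgebraicGeometry.Proj (MvPolynomial.homogeneousSubmodule (Fin (n + 1)) O)) t (𝟙 (AlgebraicGeometry.Proj (MvPolynomial.homogeneousSubmodule (Fin (n + 1)) O)) ≫ (AlgebraicGeometry.Proj.toSpecZero (MvPolynomial.homogeneousSubmodule (Fin (n + 1)) O) ≫ AlgebraicGeometry.Spec.map (CommRingCat.ofHom (algebraMap O (MvPolynomial.homogeneousSubmodule (Fin (n + 1)) O 0))))) (AlgebraicGeometry.Spec.map (CommRingCat.ofHom θ)) →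
      IsClosed (Set.range ι) → IsIrreducible (Set.range ι) → (AlgebraicGeometry.Proj.map φ hφ' : (Literature.AlgebraicGeometry.Motives.projectiveSpace n k).left ⟶ AlgebraicGeometry.Proj (MvPolynomial.homogeneousSubmodule (Fin (n + 1)) O)) '' Set.range ι = (Set.range (ι ≫ AlgebraicGeometry.Proj.map φ hφ' : H ⟶ AlgebraicGeometry.Proj (MvPolynomial.homogeneousSubmodule (Fin (n + 1)) O))) →
      -- the point step: section, its blow-up, the new stage and its model
      ∀ (x : (Literature.AlgebraicGeometry.Motives.projectiveSpace n k).left) (hx : IsClosed ({x} : Set (Literature.AlgebraicGeometry.Motives.projectiveSpace n k).left)) (U : (AlgebraicGeometry.Proj (MvPolynomial.homogeneousSubmodule (Fin (n + 1)) O)).Opens), AlgebraicGeometry.Smooth (U.ι ≫ 𝟙 (AlgebraicGeometry.Proj (MvPolynomial.homogeneousSubmodule (Fin (n + 1)) O)) ≫ (AlgebraicGeometry.Proj.toSpecZero (MvPolynomial.homogeneousSubmodule (Fin (n + 1)) O) ≫ AlgebraicGeometry.Spec.map (CommRingCat.ofHom (algebraMap O (MvPolynomial.homogeneousSubmodule (Fin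 (n + 1)) O 0))))) →
      ∀ (s : AlgebraicGeometry.Spec (.of O) ⟶ (AlgebraicGeometry.Proj (MvPolynomial.homogeneousSubmodule (Fin (n + 1)) O))), s ≫ 𝟙 (AlgebraicGeometry.Proj (MvPolynomial.homogeneousSubmodule (Fin (n + 1)) O)) ≫ (AlgebraicGeometry.Proj.toSpecZero (MvPolynomial.homogeneousSubmodule (Fin (n + 1)) O) ≫ AlgebraicGeometry.Spec.map (CommRingCat.ofHom (algebraMap O (MvPolynomial.homogeneousSubmodule (Fin (n + 1)) O 0)))) = 𝟙 _ → s (IsLocalRing.closedPoint O) ∈ U →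
        s (IsLocalRing.closedPoint O) = (AlgebraicGeometry.Proj.map φ hφ' : (Literature.AlgebraicGeometry.Motives.projectiveSpace n k).left ⟶ AlgebraicGeometry.Proj (MvPolynomial.homogeneousSubmodule (Fin (n + 1)) O)) x →
        ringKrullDim ((AlgebraicGeometry.Proj (MvPolynomial.homogeneousSubmodule (Fin (n + 1)) O)).presheaf.stalk (s (IsLocalRing.closedPoint O))) = ((n + 1 : ℕ) : WithBot ℕ∞) →
        IsRegularLocalRing ((Literature.AlgebraicGeometry.Motives.projectiveSpace n k).left.presheaf.stalk x) →
        (∀ c ∈ (s.ker.support : Set (AlgebraicGeometry.Proj (MvPolynomial.homogeneousSubmodule (Fin (n + 1)) O))), ¬ IsGenericPoint ((𝟙 (AlgebraicGeometry.Proj (MvPolynomial.homogeneousSubmodule (Fin (n + 1)) O)) : (AlgebraicGeometry.Proj (MvPolynomial.homogeneousSubmodule (Fin (n + 1)) O)) ⟶ (AlgebraicGeometry.Proj (MvPolynomial.homogeneousSubmodule (Fin (n + 1)) O))) c) (Set.range (ι ≫ AlgebraicGeometry.Proj.map φ hφ' : H ⟶ AlgebraicGeometry.Proj (MvPolynomial.homogeneousSubmodule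 (Fin (n + 1)) O)))) →
      ∀ (X₁ : AlgebraicGeometry.Scheme.{0}) (τ₁ : X₁ ⟶ (AlgebraicGeometry.Proj (MvPolynomial.homogeneousSubmodule (Fin (n + 1)) O))), Literature.AlgebraicGeometry.Resolution.IsBlowup τ₁ s.ker →
        AlgebraicGeometry.IsIntegral X₁ → IsLocallyNoetherian X₁ → Literature.AlgebraicGeometry.Resolution.Scheme.IsRegular X₁ →
        AlgebraicGeometry.IsDominant ((τ₁ ≫ 𝟙 (AlgebraicGeometry.Proj (MvPolynomial.homogeneousSubmodule (Fin (n + 1)) O))) ≫ (AlgebraicGeometry.Proj.toSpecZero (MvPolynomial.homogeneousSubmodule (Fin (n + 1)) O) ≫ AlgebraicGeometry.Spec.map (CommRingCat.ofHom (algebraMap O (MvPolynomial.homogeneousSubmodule (Fin (n + 1)) O 0))))) →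
      ∀ (F₂ : AlgebraicGeometry.Scheme.{0}), AlgebraicGeometry.IsIntegral F₂ → ∀ (υ : F₂ ⟶ (Literature.AlgebraicGeometry.Motives.projectiveSpace n k).left),
        Literature.AlgebraicGeometry.Resolution.IsBlowup υ
          (AlgebraicGeometry.Scheme.IdealSheafData.vanishingIdeal (⟨{x}, hx⟩ : TopologicalSpace.Closeds (Literature.AlgebraicGeometry.Motives.projectiveSpace n k).left)) →
      ∀ (j₂ : F₂ ⟶ X₁) (t₂ : F₂ ⟶ AlgebraicGeometry.Spec (.of k)),
        IsPullback j₂ t₂ ((τ₁ ≫ 𝟙 (AlgebraicGeometry.Proj (MvPolynomial.homogeneousSubmodule (Fin (n + 1)) O))) ≫ (AlgebraicGeometry.Proj.toSpecZero (MvPolynomial.homogeneousSubmodule (Fin (n + 1)) O) ≫ AlgebraicGeometry.Spec.map (CommRingCat.ofHom (algebraMap O (MvPolynomial.homogeneousSubmodule (Fin (n + 1)) O 0))))) (AlgebraicGeometry.Spec.map (CommRingCat.ofHom θ)) → j₂ ≫ τ₁ = υ ≫ (AlgebraicGeometry.Proj.map φ hφ' : (Literature.AlgebraicGeometry.Motives.projectiveSpace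 n k).left ⟶ AlgebraicGeometry.Proj (MvPolynomial.homogeneousSubmodule (Fin (n + 1)) O)) →
        (s.ker.comap τ₁).comap j₂ =
          (AlgebraicGeometry.Scheme.IdealSheafData.vanishingIdeal (⟨{x}, hx⟩ : TopologicalSpace.Closeds (Literature.AlgebraicGeometry.Motives.projectiveSpace n k).left)).comap υ →
        IsIrreducible (closure (υ ⁻¹' (Set.range ι \ {x}))) →
        Ch X₁ (τ₁ ≫ 𝟙 (AlgebraicGeometry.Proj (MvPolynomial.homogeneousSubmodule (Fin (n + 1)) O))) (j₂ '' closure (υ ⁻¹' (Set.range ι \ {x}))) →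
      -- the LETTERS and the admissible lettered downstairs sub-chains, matched upstairs
      ∀ (Ls₂ : List (Set F₂)), LS F₂ υ x Ls₂ → ∀ (F₉ : AlgebraicGeometry.Scheme.{0}) (β : F₉ ⟶ F₂) (T₉ : Set F₉), ReachL F₂ υ x (closure (υ ⁻¹' (Set.range ι \ {x}))) Ls₂ F₉ β T₉ →
        ∃ (X₉ : AlgebraicGeometry.Scheme.{0}) (σ₉ : X₉ ⟶ (AlgebraicGeometry.Proj (MvPolynomial.homogeneousSubmodule (Fin (n + 1)) O))) (S₉ : Set X₉) (j₉ : F₉ ⟶ X₉)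
          (t₉ : F₉ ⟶ AlgebraicGeometry.Spec (.of k)), Ch X₉ σ₉ S₉ ∧ AlgebraicGeometry.IsIntegral X₉ ∧ IsLocallyNoetherian X₉ ∧
          Literature.AlgebraicGeometry.Resolution.Scheme.IsRegular X₉ ∧ AlgebraicGeometry.IsDominant (σ₉ ≫ (AlgebraicGeometry.Proj.toSpecZero (MvPolynomial.homogeneousSubmodule (Fin (n + 1)) O) ≫ AlgebraicGeometry.Spec.map (CommRingCat.ofHom (algebraMap O (MvPolynomial.homogeneousSubmodule (Fin (n + 1)) O 0))))) ∧
          IsPullback j₉ t₉ (σ₉ ≫ (AlgebraicGeometry.Proj.toSpecZero (MvPolynomial.homogeneousSubmodule (Fin (n + 1)) O) ≫ AlgebraicGeometry.Spec.map (CommRingCat.ofHom (algebraMap O (MvPolynomial.homogeneousSubmodule (Fin (n + 1)) O 0))))) (AlgebraicGeometry.Spec.map (CommRingCat.ofHom θ)) ∧ j₉ '' T₉ = S₉ ∧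
          IsClosed T₉ ∧ IsIrreducible T₉ ∧ AlgebraicGeometry.IsIntegral F₉)) →
    -- the downstairs resolution by (pt) and (pt;sub-chain) steps
    (∃ (F' : AlgebraicGeometry.Scheme.{0}) (ρ' : F' ⟶ (Literature.AlgebraicGeometry.Motives.projectiveSpace n k).left) (T' : Set F'),
      (∀ Q : (∀ F₁ : AlgebraicGeometry.Scheme.{0}, (F₁ ⟶ (Literature.AlgebraicGeometry.Motives.projectiveSpace n k).left) → Set F₁ → Prop),
        Q (Literature.AlgebraicGeometry.Motives.projectiveSpace n k).left (𝟙 (Literature.AlgebraicGeometry.Motives.projectiveSpace n k).left) (Set.range ι) →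
        (∀ (F₁ F₂ : AlgebraicGeometry.Scheme.{0}) (ρ : F₁ ⟶ (Literature.AlgebraicGeometry.Motives.projectiveSpace n k).left) (T₁ : Set F₁)
            (x : ↥(AlgebraicGeometry.Scheme.IdealSheafData.vanishingIdeal (⟨closure T₁, isClosed_closure⟩ : TopologicalSpace.Closeds F₁)).subscheme) (υ : F₂ ⟶ F₁)
            (hx : IsClosed ({((AlgebraicGeometry.Scheme.IdealSheafData.vanishingIdeal
              (⟨closure T₁, isClosed_closure⟩ : TopologicalSpace.Closeds F₁)).subschemeι x : F₁)} : Set F₁)), Q F₁ ρ T₁ →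
          ¬ IsRegularLocalRing ((AlgebraicGeometry.Scheme.IdealSheafData.vanishingIdeal
              (⟨closure T₁, isClosed_closure⟩ : TopologicalSpace.Closeds F₁)).subscheme.presheaf.stalk x) →
          IsRegularLocalRing (F₁.presheaf.stalk ((AlgebraicGeometry.Scheme.IdealSheafData.vanishingIdeal
              (⟨closure T₁, isClosed_closure⟩ : TopologicalSpace.Closeds F₁)).subschemeι x)) → Literature.AlgebraicGeometry.Resolution.IsBlowup υ
            (AlgebraicGeometry.Scheme.IdealSheafData.vanishingIdeal (⟨{((AlgebraicGeometry.Scheme.IdealSheafData.vanishingIdeal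
                (⟨closure T₁, isClosed_closure⟩ : TopologicalSpace.Closeds F₁)).subschemeι x : F₁)}, hx⟩ : TopologicalSpace.Closeds F₁)) →
          Q F₂ (υ ≫ ρ) (closure (υ ⁻¹' (T₁ \ {((AlgebraicGeometry.Scheme.IdealSheafData.vanishingIdeal
              (⟨closure T₁, isClosed_closure⟩ : TopologicalSpace.Closeds F₁)).subschemeι x : F₁)}))) ∧ (∀ (F₉ : AlgebraicGeometry.Scheme.{0}) (β : F₉ ⟶ F₂) (T₉ : Set F₉),
            Reach F₁ F₂ υ ((AlgebraicGeometry.Scheme.IdealSheafData.vanishingIdeal (⟨closure T₁, isClosed_closure⟩ : TopologicalSpace.Closeds F₁)).subschemeι x)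
              (closure (υ ⁻¹' (T₁ \ {((AlgebraicGeometry.Scheme.IdealSheafData.vanishingIdeal
                (⟨closure T₁, isClosed_closure⟩ : TopologicalSpace.Closeds F₁)).subschemeι x : F₁)}))) F₉ β T₉ → Q F₉ ((β ≫ υ) ≫ ρ) T₉)) →
        -- A⁗: at the INITIAL stage only, LETTERED towers after a good point step
        (∀ (F₂ : AlgebraicGeometry.Scheme.{0}) (x₀ : ↥(AlgebraicGeometry.Scheme.IdealSheafData.vanishingIdeal
              (⟨closure (Set.range ι), isClosed_closure⟩ : TopologicalSpace.Closeds (Literature.AlgebraicGeometry.Motives.projectiveSpace n k).left)).subscheme)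
            (υ : F₂ ⟶ (Literature.AlgebraicGeometry.Motives.projectiveSpace n k).left) (hx₀ : IsClosed ({((AlgebraicGeometry.Scheme.IdealSheafData.vanishingIdeal
              (⟨closure (Set.range ι), isClosed_closure⟩ : TopologicalSpace.Closeds (Literature.AlgebraicGeometry.Motives.projectiveSpace n k).left)).subschemeι x₀ : (Literature.AlgebraicGeometry.Motives.projectiveSpace n k).left)} : Set (Literature.AlgebraicGeometry.Motives.projectiveSpace n k).left))
            (Ls₂ : List (Set F₂)), ¬ IsRegularLocalRing ((AlgebraicGeometry.Scheme.IdealSheafData.vanishingIdeal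
              (⟨closure (Set.range ι), isClosed_closure⟩ : TopologicalSpace.Closeds (Literature.AlgebraicGeometry.Motives.projectiveSpace n k).left)).subscheme.presheaf.stalk x₀) →
          IsRegularLocalRing ((Literature.AlgebraicGeometry.Motives.projectiveSpace n k).left.presheaf.stalk ((AlgebraicGeometry.Scheme.IdealSheafData.vanishingIdeal
              (⟨closure (Set.range ι), isClosed_closure⟩ : TopologicalSpace.Closeds (Literature.AlgebraicGeometry.Motives.projectiveSpace n k).left)).subschemeι x₀ : (Literature.AlgebraicGeometry.Motives.projectiveSpace n k).left)) →
          Literature.AlgebraicGeometry.Resolution.IsBlowup υ (AlgebraicGeometry.Scheme.IdealSheafData.vanishingIdeal (⟨{((AlgebraicGeometry.Scheme.IdealSheafData.vanishingIdeal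
              (⟨closure (Set.range ι), isClosed_closure⟩ : TopologicalSpace.Closeds (Literature.AlgebraicGeometry.Motives.projectiveSpace n k).left)).subschemeι x₀ : (Literature.AlgebraicGeometry.Motives.projectiveSpace n k).left)}, hx₀⟩ : TopologicalSpace.Closeds (Literature.AlgebraicGeometry.Motives.projectiveSpace n k).left)) →
          LS F₂ υ ((AlgebraicGeometry.Scheme.IdealSheafData.vanishingIdeal
              (⟨closure (Set.range ι), isClosed_closure⟩ : TopologicalSpace.Closeds (Literature.AlgebraicGeometry.Motives.projectiveSpace n k).left)).subschemeι x₀ : (Literature.AlgebraicGeometry.Motives.projectiveSpace n k).left) Ls₂ →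
          ∀ (F₉ : AlgebraicGeometry.Scheme.{0}) (β : F₉ ⟶ F₂) (T₉ : Set F₉), ReachL F₂ υ ((AlgebraicGeometry.Scheme.IdealSheafData.vanishingIdeal
              (⟨closure (Set.range ι), isClosed_closure⟩ : TopologicalSpace.Closeds (Literature.AlgebraicGeometry.Motives.projectiveSpace n k).left)).subschemeι x₀ : (Literature.AlgebraicGeometry.Motives.projectiveSpace n k).left) (closure (υ ⁻¹' (Set.range ι \ {((AlgebraicGeometry.Scheme.IdealSheafData.vanishingIdeal
              (⟨closure (Set.range ι), isClosed_closure⟩ : TopologicalSpace.Closeds (Literature.AlgebraicGeometry.Motives.projectiveSpace n k).left)).subschemeι x₀ : (Literature.AlgebraicGeometry.Motives.projectiveSpace n k).left)}))) Ls₂ F₉ β T₉ →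
            Q F₉ (β ≫ υ) T₉) → Q F' ρ' T') ∧ Literature.AlgebraicGeometry.Resolution.Scheme.IsRegular (AlgebraicGeometry.Scheme.IdealSheafData.vanishingIdeal
        (⟨closure T', isClosed_closure⟩ : TopologicalSpace.Closeds F')).subscheme) →
    ∃ (O : Type) (_ : CommRing O) (_ : IsDomain O) (_ : IsDiscreteValuationRing O) (_ : CharZero O) (π : O →+* k),
      Function.Surjective π ∧ (letI := MvPolynomial.gradedAlgebra (σ := Fin (n + 1)) (R := O); letI := MvPolynomial.gradedAlgebra (σ := Fin (n + 1)) (R := k);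
        ∀ (φ : MvPolynomial.homogeneousSubmodule (Fin (n + 1)) O →+*ᵍ MvPolynomial.homogeneousSubmodule (Fin (n + 1)) k)
          (hφ' : HomogeneousIdeal.irrelevant (MvPolynomial.homogeneousSubmodule (Fin (n + 1)) k) ≤
            (HomogeneousIdeal.irrelevant (MvPolynomial.homogeneousSubmodule (Fin (n + 1)) O)).map φ), (∀ s, φ s = MvPolynomial.map π s) →
          ∀ Y : Set (AlgebraicGeometry.Proj (MvPolynomial.homogeneousSubmodule (Fin (n + 1)) O)), Y = Set.range (ι ≫ AlgebraicGeometry.Proj.map φ hφ' :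
              H ⟶ AlgebraicGeometry.Proj (MvPolynomial.homogeneousSubmodule (Fin (n + 1)) O)) → ∃ (P' : AlgebraicGeometry.Scheme.{0})
              (σ : P' ⟶ AlgebraicGeometry.Proj (MvPolynomial.homogeneousSubmodule (Fin (n + 1)) O)) (S' : Set P'), (∀ Q : (∀ X' : AlgebraicGeometry.Scheme.{0},
                  (X' ⟶ AlgebraicGeometry.Proj (MvPolynomial.homogeneousSubmodule (Fin (n + 1)) O)) → Set X' → Prop),
                Q (AlgebraicGeometry.Proj (MvPolynomial.homogeneousSubmodule (Fin (n + 1)) O)) (𝟙 _) Y → (∀ (X' X'' : AlgebraicGeometry.Scheme.{0})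
                    (σ' : X' ⟶ AlgebraicGeometry.Proj (MvPolynomial.homogeneousSubmodule (Fin (n + 1)) O)) (Y' : Set X') (C : X'.IdealSheafData) (τ : X'' ⟶ X'),
                  Q X' σ' Y' → Literature.AlgebraicGeometry.Resolution.IsBlowup τ C → Literature.AlgebraicGeometry.Resolution.Scheme.IsRegular C.subscheme →
                  AlgebraicGeometry.Flat (C.subschemeι ≫ σ' ≫ AlgebraicGeometry.Proj.toSpecZero (MvPolynomial.homogeneousSubmodule (Fin (n + 1)) O) ≫
                      AlgebraicGeometry.Spec.map (CommRingCat.ofHom (algebraMap O (MvPolynomial.homogeneousSubmodule (Fin (n + 1)) O 0)))) →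
                  σ' '' (C.support : Set X') ⊆ {x | ¬ IsGenericPoint x Y} → (C.support : Set X') ∩ (σ' ≫
                    AlgebraicGeometry.Proj.toSpecZero (MvPolynomial.homogeneousSubmodule (Fin (n + 1)) O) ≫ AlgebraicGeometry.Spec.map (CommRingCat.ofHom
                        (algebraMap O (MvPolynomial.homogeneousSubmodule (Fin (n + 1)) O 0)))) ⁻¹' {IsLocalRing.closedPoint O} ⊆ Y' →
                  Q X'' (τ ≫ σ') (closure (τ ⁻¹' (Y' \ (C.support : Set X'))))) → Q P' σ S') ∧ Literature.AlgebraicGeometry.Resolution.Scheme.IsRegular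
                (AlgebraicGeometry.Scheme.IdealSheafData.vanishingIdeal (⟨closure S', isClosed_closure⟩ : TopologicalSpace.Closeds P')).subscheme):= by
  classical
  intro hp k _ _ _ n H ι hι hH hpr Reach ReachL LS HSUB HSUB₂ hres
  obtain ⟨O, i1, i2, i3, i4, i5, i6, π, hπ⟩ := stub_wittRing p hp k
  refine ⟨O, i1, i2, i3, i4, π, hπ, ?_⟩
  letI := MvPolynomial.gradedAlgebra (σ := Fin (n + 1)) (R := O)
  letI := MvPolynomial.gradedAlgebra (σ := Fin (n + 1)) (R := k)
  intro φ hφ' hφ Y hYdef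
  subst hYdef
  -- the fixed ambient `P = ℙⁿ_O`, `q`, and the BASE MODEL SQUARE `g : ℙⁿ_k → ℙⁿ_O`
  set q : Proj (homogeneousSubmodule (Fin (n + 1)) O) ⟶ Spec (.of O) :=
    Proj.toSpecZero (homogeneousSubmodule (Fin (n + 1)) O) ≫
      Spec.map (CommRingCat.ofHom (algebraMap O (homogeneousSubmodule (Fin (n + 1)) O 0))) with hq
  have hP := ProjectiveAmbientFibre.isPullback_projMap π φ hφ hπ hφ'
  set g : Proj (homogeneousSubmodule (Fin (n + 1)) k) ⟶ Proj (homogeneousSubmodule (Fin (n + 1)) O) :=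
    Proj.map φ hφ' with hg
  haveI : IsClosedImmersion (Spec.map (CommRingCat.ofHom π)) := IsClosedImmersion.spec_of_surjective _ hπ
  haveI : IsClosedImmersion g := MorphismProperty.IsStableUnderBaseChange.of_isPullback hP.flip inferInstance
  have hsq₀ : IsPullback g (Proj.toSpecZero (homogeneousSubmodule (Fin (n + 1)) k) ≫
      Spec.map (CommRingCat.ofHom (algebraMap k (homogeneousSubmodule (Fin (n + 1)) k 0))))
      (𝟙 _ ≫ q) (Spec.map (CommRingCat.ofHom π)) := by
    rw [Category.id_comp]; exact hP
  have hrangeg : Set.range g = q ⁻¹' {IsLocalRing.closedPoint O} := by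
    rw [range_eq_preimage_of_isPullback hP, range_specMap_of_surjective_of_field π hπ]
  -- the closed immersion `f = ι ≫ g : H ⟶ ℙⁿ_O` and its (closed) range `Y`
  haveI := hH
  let ι' : H ⟶ Proj (homogeneousSubmodule (Fin (n + 1)) k) := ι
  haveI : IsClosedImmersion ι' := hι
  let f : H ⟶ Proj (homogeneousSubmodule (Fin (n + 1)) O) := ι' ≫ g
  let Yc : Closeds (Proj (homogeneousSubmodule (Fin (n + 1)) O)) := ⟨Set.range f, f.isClosedEmbedding.isClosed_range⟩
  have hYc : (Yc : Set (Proj (homogeneousSubmodule (Fin (n + 1)) O))) = Set.range (ι ≫ Proj.map φ hφ') := rfl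
  have hsub : (Yc : Set (Proj (homogeneousSubmodule (Fin (n + 1)) O))) ⊆ q ⁻¹' {IsLocalRing.closedPoint O} := by
    rintro _ ⟨x, rfl⟩
    rw [← hrangeg]
    exact ⟨ι' x, (Scheme.Hom.comp_apply _ _ x).symm⟩
  obtain ⟨hsm, hprop⟩ := stub_projectiveAmbientSmoothProper O n
  haveI : IsProper q := hprop
  -- `Y` is irreducible (image of the integral `H`)
  have hYirr : IsIrreducible (Yc : Set (Proj (homogeneousSubmodule (Fin (n + 1)) O))) := by
    have h := (IrreducibleSpace.isIrreducible_univ H).image f f.continuous.continuousOn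
    rwa [Set.image_univ] at h
  obtain ⟨ξ, hξ⟩ : ∃ ξ : Proj (homogeneousSubmodule (Fin (n + 1)) O), IsGenericPoint ξ (Yc : Set _) :=
    QuasiSober.sober hYirr Yc.isClosed
  -- EL♮'s HORIZONTAL induction principle as a stage predicate over the fixed base
  obtain ⟨Ch, hCh⟩ : ∃ Ch : ∀ X' : Scheme.{0}, (X' ⟶ Proj (homogeneousSubmodule (Fin (n + 1)) O)) → Set X' → Prop,
      ∀ (X₁ : Scheme.{0}) (σ₁ : X₁ ⟶ Proj (homogeneousSubmodule (Fin (n + 1)) O)) (S₁ : Set X₁), Ch X₁ σ₁ S₁ ↔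
      ∀ Q : (∀ X' : Scheme.{0}, (X' ⟶ Proj (homogeneousSubmodule (Fin (n + 1)) O)) → Set X' → Prop),
        Q (Proj (homogeneousSubmodule (Fin (n + 1)) O)) (𝟙 _) (Yc : Set (Proj (homogeneousSubmodule (Fin (n + 1)) O))) →
        (∀ (X' X'' : Scheme.{0}) (σ' : X' ⟶ Proj (homogeneousSubmodule (Fin (n + 1)) O)) (Y' : Set X')
          (C : X'.IdealSheafData) (τ : X'' ⟶ X'), Q X' σ' Y' → IsBlowup τ C → Scheme.IsRegular C.subscheme →
          Flat (C.subschemeι ≫ σ' ≫ q) →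
          σ' '' (C.support : Set X') ⊆ {x | ¬ IsGenericPoint x (Yc : Set (Proj (homogeneousSubmodule (Fin (n + 1)) O)))} →
          (C.support : Set X') ∩ (σ' ≫ q) ⁻¹' {IsLocalRing.closedPoint O} ⊆ Y' →
          Q X'' (τ ≫ σ') (closure (τ ⁻¹' (Y' \ (C.support : Set X'))))) →
        Q X₁ σ₁ S₁ := ⟨_, fun _ _ _ => Iff.rfl⟩
  have hChain : ∀ (X' : Scheme.{0}) (σ : X' ⟶ Proj (homogeneousSubmodule (Fin (n + 1)) O)) (S : Set X'),
      Ch X' σ S → Chain (Proj (homogeneousSubmodule (Fin (n + 1)) O))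
        (Yc : Set (Proj (homogeneousSubmodule (Fin (n + 1)) O))) X' σ S :=
    fun X' σ S h Q h0 hs => (hCh X' σ S).mp h Q h0
      (fun X₁ X₂ σ' Y' C τ hQ hb hr _ hg' _ => hs X₁ X₂ σ' Y' C τ hQ hb hr hg')
  have hStep : ∀ (X' X'' : Scheme.{0}) (σ' : X' ⟶ Proj (homogeneousSubmodule (Fin (n + 1)) O)) (S' : Set X')
      (C : X'.IdealSheafData) (τ : X'' ⟶ X'),
      Ch X' σ' S' → IsBlowup τ C → Scheme.IsRegular C.subscheme → Flat (C.subschemeι ≫ σ' ≫ q) →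
      σ' '' (C.support : Set X') ⊆ {x | ¬ IsGenericPoint x (Yc : Set (Proj (homogeneousSubmodule (Fin (n + 1)) O)))} →
      (C.support : Set X') ∩ (σ' ≫ q) ⁻¹' {IsLocalRing.closedPoint O} ⊆ S' →
      Ch X'' (τ ≫ σ') (closure (τ ⁻¹' (S' \ (C.support : Set X')))) :=
    fun X' X'' σ' S' C τ h hb hr hfl hg' hE => (hCh _ _ _).mpr fun Q h0 hs =>
      hs X' X'' σ' S' C τ ((hCh X' σ' S').mp h Q h0 hs) hb hr hfl hg' hE
  have hCh₀ : Ch (Proj (homogeneousSubmodule (Fin (n + 1)) O)) (𝟙 _)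
      (Yc : Set (Proj (homogeneousSubmodule (Fin (n + 1)) O))) := (hCh _ _ _).mpr fun Q h0 _ => h0
  have hPnoeth : IsLocallyNoetherian (Proj (homogeneousSubmodule (Fin (n + 1)) O)) :=
    LocallyOfFiniteType.isLocallyNoetherian q
  have hPreg : Scheme.IsRegular (Proj (homogeneousSubmodule (Fin (n + 1)) O)) := fun y => (stub_goodAtOfSmooth O _ q hsm y).1
  -- THE INDUCTION PREDICATE: closed irreducible strict transform in an integral ambient which IS the special fibre of an upstairs
  -- horizontal-E1 stage (the MODEL SQUARE), with matching strict-transform sets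
  let QD : ∀ F₁ : Scheme.{0}, (F₁ ⟶ (Literature.AlgebraicGeometry.Motives.projectiveSpace n k).left) → Set F₁ → Prop :=
    fun F₁ _ T₁ => IsClosed T₁ ∧ IsIrreducible T₁ ∧ IsIntegral F₁ ∧
      ∃ (X' : Scheme.{0}) (σ' : X' ⟶ Proj (homogeneousSubmodule (Fin (n + 1)) O)) (S' : Set X')
        (j : F₁ ⟶ X') (t : F₁ ⟶ Spec (.of k)),
        Ch X' σ' S' ∧ IsIntegral X' ∧ IsLocallyNoetherian X' ∧ Scheme.IsRegular X' ∧ IsDominant (σ' ≫ q) ∧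
        IsPullback j t (σ' ≫ q) (Spec.map (CommRingCat.ofHom π)) ∧ j '' T₁ = S'
  -- THE INDUCTION along the downstairs closure
  obtain ⟨F', ρ', T', hclos, hregD⟩ := hres
  have hQD : QD F' ρ' T' := by
    refine hclos QD ?_ ?_ ?_
    · -- BASE: `(ℙⁿ_k, 𝟙, range ι)` IS the special fibre of `(ℙⁿ_O, 𝟙, Y)`
      haveI : Nonempty H := inferInstance
      haveI : Nonempty (Proj (homogeneousSubmodule (Fin (n + 1)) O)) := ⟨f (Classical.arbitrary H)⟩
      haveI : Smooth q := hsm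
      haveI : IsDominant q := isDominant_of_smooth_of_nonempty q
      have hdom₀ : IsDominant (𝟙 (Proj (homogeneousSubmodule (Fin (n + 1)) O)) ≫ q) := by
        rw [Category.id_comp]; infer_instance
      have hirrι : IsIrreducible (Set.range ι') := by
        have h := (IrreducibleSpace.isIrreducible_univ H).image ι' ι'.continuous.continuousOn
        rwa [Set.image_univ] at h
      refine ⟨ι'.isClosedEmbedding.isClosed_range, hirrι, isIntegral_proj_homogeneousSubmodule n k, _, 𝟙 _,
        (Yc : Set (Proj (homogeneousSubmodule (Fin (n + 1)) O))), g, _, hCh₀,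
        Proj.isIntegral _ (irrelevant_homogeneousSubmodule_ne_bot n O), hPnoeth, hPreg, hdom₀, hsq₀, ?_⟩
      change g '' Set.range ι' = Set.range f
      rw [← Set.range_comp]
      rfl
    · -- STEPS
      intro F₁ F₂ ρ T₁ x υ hx hQ₁ hxreg hFreg hυ
      obtain ⟨hT₁cl, hT₁irr, hF₁, X', σ', S', j, t, hChX, hX'int, hX'noeth, hX'reg, hdom, hsq, hTS⟩ := hQ₁
      haveI := hF₁
      haveI := hX'int
      haveI := hX'noeth
      obtain ⟨hF₂, hT₂irr, U, s, X'', τ, j₂, t₂, hproper, hU, hs, hsU, hss₀, hoffs, hτ, hcomm, hE, hCh'', hint'', hnoeth'',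
        hreg'', hdom'', hsq₂⟩ := modelPointStep_chain' O k π hπ _ q (Yc : Set (Proj (homogeneousSubmodule (Fin (n + 1)) O))) hsub hYirr
          Yc.isClosed hPnoeth hPreg Ch hChain hStep X' σ' S' hChX hX'reg hdom F₁ j t hsq T₁ hT₁cl hT₁irr hTS x hx hxreg hFreg
          F₂ υ hυ
      haveI := hF₂
      haveI := hint''
      haveI := hnoeth''
      haveI hj₂ci : IsClosedImmersion j₂ := MorphismProperty.IsStableUnderBaseChange.of_isPullback hsq₂.flip inferInstance
      refine ⟨⟨isClosed_closure, hT₂irr, hF₂, X'', τ ≫ σ', _, j₂, t₂, hCh'', hint'', hnoeth'', hreg'', hdom'', hsq₂, rfl⟩, ?_⟩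
      -- the sub-chain: handed to the supplier
      intro F₉ β T₉ hReach
      -- T-DIM: the running ambient has local dimension `n + 1` at the section point
      haveI hjci : IsClosedImmersion j := MorphismProperty.IsStableUnderBaseChange.of_isPullback hsq.flip inferInstance
      have hwcl : IsClosed ({s (IsLocalRing.closedPoint O)} : Set X') := by
        rw [hss₀]
        have h := hjci.isClosedEmbedding.isClosedMap _ hx
        rwa [Set.image_singleton] at h
      have hws₀ : (σ' ≫ q).base (s (IsLocalRing.closedPoint O)) = IsLocalRing.closedPoint O := by
        change (s ≫ σ' ≫ q) (IsLocalRing.closedPoint O) = _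
        rw [hs]; rfl
      haveI hPint : IsIntegral (Proj (homogeneousSubmodule (Fin (n + 1)) O)) :=
        Proj.isIntegral _ (irrelevant_homogeneousSubmodule_ne_bot n O)
      haveI hsrd : SmoothOfRelativeDimension n q := smoothOfRelativeDimension_toSpecZero_specMap n O
      have hdim : ringKrullDim (X'.presheaf.stalk (s (IsLocalRing.closedPoint O))) = ((n + 1 : ℕ) : WithBot ℕ∞) :=
        ringKrullDim_stalk_eq_succ_of_chain q n hξ (hChain _ _ _ hChX) hwcl hws₀
      obtain ⟨X₉, σ₉, S₉, j₉, t₉, hCh₉, hint₉, hnoeth₉, hreg₉, hdom₉, hsq₉, hsets₉, hT₉cl, hT₉irr, hF₉⟩ :=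
        HSUB O π hπ _ q (Yc : Set (Proj (homogeneousSubmodule (Fin (n + 1)) O))) Ch hStep hChain hsub hYirr Yc.isClosed
          hPint hPnoeth hPreg hprop hsrd X' σ' S' hChX hX'int hX'noeth hX'reg hdom F₁ hF₁ j t hsq T₁ hT₁cl hT₁irr hTS _ hx U
          hU s hs hsU hss₀ hdim hFreg hoffs X'' τ hτ hint'' hnoeth'' hreg'' hdom'' F₂ hF₂ υ hυ j₂ t₂ hsq₂ hcomm hE hT₂irr hCh''
          F₉ β T₉ hReach
      exact ⟨hT₉cl, hT₉irr, hF₉, X₉, σ₉, S₉, j₉, t₉, hCh₉, hint₉, hnoeth₉, hreg₉, hdom₉, hsq₉, hsets₉⟩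
    · -- A⁗: LETTERED TOWERS AT THE INITIAL STAGE — the point step is run at the base stage `(ℙⁿ_O, 𝟙, Y)`, then HSUB₂
      intro F₂ x₀ υ hx₀ Ls₂ hxreg hFreg hυ hLs F₉ β T₉ hReachL
      haveI : Nonempty H := inferInstance
      haveI : Nonempty (Proj (homogeneousSubmodule (Fin (n + 1)) O)) := ⟨f (Classical.arbitrary H)⟩
      haveI : Smooth q := hsm
      haveI : IsDominant q := isDominant_of_smooth_of_nonempty q
      have hdom₀ : IsDominant (𝟙 (Proj (homogeneousSubmodule (Fin (n + 1)) O)) ≫ q) := by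
        rw [Category.id_comp]; infer_instance
      have hirrι : IsIrreducible (Set.range ι') := by
        have h := (IrreducibleSpace.isIrreducible_univ H).image ι' ι'.continuous.continuousOn
        rwa [Set.image_univ] at h
      have hT₁cl : IsClosed (Set.range ι') := ι'.isClosedEmbedding.isClosed_range
      haveI hF₁ : IsIntegral (Proj (homogeneousSubmodule (Fin (n + 1)) k)) := isIntegral_proj_homogeneousSubmodule n k
      haveI hPint : IsIntegral (Proj (homogeneousSubmodule (Fin (n + 1)) O)) :=
        Proj.isIntegral _ (irrelevant_homogeneousSubmodule_ne_bot n O)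
      have hTS : g '' Set.range ι' = (Yc : Set (Proj (homogeneousSubmodule (Fin (n + 1)) O))) := by
        change g '' Set.range ι' = Set.range f
        rw [← Set.range_comp]
        rfl
      obtain ⟨hF₂, hT₂irr, U, s, X'', τ, j₂, t₂, hproper, hU, hs, hsU, hss₀, hoffs, hτ, hcomm, hE, hCh'', hint'', hnoeth'',
        hreg'', hdom'', hsq₂⟩ := modelPointStep_chain' O k π hπ _ q (Yc : Set (Proj (homogeneousSubmodule (Fin (n + 1)) O))) hsub hYirr
          Yc.isClosed hPnoeth hPreg Ch hChain hStep _ (𝟙 _) _ hCh₀ hPreg hdom₀ _ g _ hsq₀ (Set.range ι') hT₁cl hirrι hTS x₀ hx₀ hxreg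
          hFreg F₂ υ hυ
      haveI := hF₂
      haveI := hint''
      haveI := hnoeth''
      have hwcl : IsClosed ({s (IsLocalRing.closedPoint O)} : Set (Proj (homogeneousSubmodule (Fin (n + 1)) O))) := by
        rw [hss₀]
        have h := (inferInstance : IsClosedImmersion g).isClosedEmbedding.isClosedMap
          ({((Scheme.IdealSheafData.vanishingIdeal (⟨closure (Set.range ι), isClosed_closure⟩ :
              Closeds (Proj (homogeneousSubmodule (Fin (n + 1)) k)))).subschemeι x₀ :
              Proj (homogeneousSubmodule (Fin (n + 1)) k))} : Set (Proj (homogeneousSubmodule (Fin (n + 1)) k))) hx₀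
        rwa [Set.image_singleton] at h
      have hws₀ : (𝟙 (Proj (homogeneousSubmodule (Fin (n + 1)) O)) ≫ q).base (s (IsLocalRing.closedPoint O)) =
          IsLocalRing.closedPoint O := by
        change (s ≫ 𝟙 _ ≫ q) (IsLocalRing.closedPoint O) = _
        rw [hs]; rfl
      haveI hsrd : SmoothOfRelativeDimension n q := smoothOfRelativeDimension_toSpecZero_specMap n O
      have hdim : ringKrullDim ((Proj (homogeneousSubmodule (Fin (n + 1)) O)).presheaf.stalk (s (IsLocalRing.closedPoint O))) =
          ((n + 1 : ℕ) : WithBot ℕ∞) :=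
        ringKrullDim_stalk_eq_succ_of_chain q n hξ (hChain _ _ _ hCh₀) hwcl hws₀
      obtain ⟨X₉, σ₉, S₉, j₉, t₉, hCh₉, hint₉, hnoeth₉, hreg₉, hdom₉, hsq₉, hsets₉, hT₉cl, hT₉irr, hF₉⟩ :=
        HSUB₂ O π hπ φ hφ' hφ Ch hStep hChain hsub hYirr Yc.isClosed hPint hPnoeth hPreg hprop hsrd hCh₀ hdom₀ hF₁ _ hsq₀ hT₁cl hirrι
          hTS _ hx₀ U hU s hs hsU hss₀ hdim hFreg hoffs X'' τ hτ hint'' hnoeth'' hreg'' hdom'' F₂ hF₂ υ hυ j₂ t₂ hsq₂ hcomm hE hT₂irr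
          hCh'' Ls₂ hLs F₉ β T₉ hReachL
      exact ⟨hT₉cl, hT₉irr, hF₉, X₉, σ₉, S₉, j₉, t₉, hCh₉, hint₉, hnoeth₉, hreg₉, hdom₉, hsq₉, hsets₉⟩
  -- THE END: transport the downstairs regularity through the model
  obtain ⟨hT'cl, -, -, X₁, σ₁, S₁, j₁, t₁, hCh₁, -, -, -, -, hsq₁, hTS₁⟩ := hQD
  haveI hj₁ci : IsClosedImmersion j₁ := MorphismProperty.IsStableUnderBaseChange.of_isPullback hsq₁.flip inferInstance
  have hT'img : IsClosed (j₁ '' T') := hj₁ci.isClosedEmbedding.isClosedMap _ hT'cl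
  have hZ1 : (⟨closure T', isClosed_closure⟩ : Closeds F') = ⟨T', hT'cl⟩ := Closeds.ext hT'cl.closure_eq
  have hZ2 : (⟨closure S₁, isClosed_closure⟩ : Closeds X₁) = ⟨j₁ '' T', hT'img⟩ :=
    Closeds.ext (by change closure S₁ = j₁ '' T'; rw [← hTS₁]; exact hT'img.closure_eq)
  rw [hZ1] at hregD
  refine ⟨X₁, σ₁, S₁, (hCh X₁ σ₁ S₁).mp hCh₁, ?_⟩
  rw [hZ2]
  exact (isRegular_subscheme_vanishingIdeal_image_iff j₁ ⟨T', hT'cl⟩ hT'img).mpr hregD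

end Summit.ResolutionOfSingularities.ResolutionOfSingularities.Cruxes.EquisingularLiftNat.Sections

end
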